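import Summits.ResolutionOfSingularities.ResolutionOfSingularities.Theorems.PAlterationPicoverLogRegularFreeChart
import Literature.AlgebraicGeometry.Resolution.LogRegularAtlas
import Literature.AlgebraicGeometry.Resolution.LogRegularScheme
import Literature.AlgebraicGeometry.Resolution.ProjectiveSpaceRegular
import HarnessLib

set_option linter.dupNamespace false -- mandated namespace of this single-conjunct summit

/-!
# A scheme with a log-regular atlas by FREE chart monoids is regular

Crux `Picover` (stmt-ResolutionOfSingularities-0554), line `giraud-separated-base`, stub
`isRegular_of_logRegularAtlas_of_free`: the terminal, scheme-level step of Kato 1994, (10.4) —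
once the fan of a log regular scheme has been subdivided until every chart monoid is free
(generated, as an additive monoid, by a `ℤ`-basis of its lattice `ℤ^{nᵢ}`), the scheme is
regular.

**Proof.** Regularity is local and, on the affine chart `Uᵢ`, amounts to the regularity of every
localisation `Γ(X, Uᵢ)_𝔭` (`Scheme.isRegular_of_isRegularRing`, `isRegularRing_iff`). At a prime
`𝔭`, Kato's condition (2.1) for the chart `φᵢ` read in the local ring `R = Γ(X, Uᵢ)_𝔭`
(`LogChart.isLogRegularAt_iff_isLogRegularLocal`) is fed to the pointwise step
`LogRegularFreeChart.isRegularLocalRing_of_isLogRegularLocal_of_span`: if `P = ⟨b₁, …, bₙ⟩` with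
images `uⱼ = φ(bⱼ) ∈ R`, split the indices into `J = {j | uⱼ ∉ R^×}` and `K = {j | uⱼ ∈ R^×}`.
Every chart element is `v = Σ cⱼ bⱼ` (`cⱼ ∈ ℕ`) with image `∏ uⱼ^{cⱼ}`, which is a non-unit iff
some `j ∈ J` occurs; hence Kato's ideal `I = (φ(P ∖ F))` is generated by `q = {uⱼ | j ∈ J}`, and
the face of units `F` lies in the span of `{bⱼ | j ∈ K}`, so `|q| + rank_ℤ Fᵍᵖ ≤ |J| + |K| = n`.
-/

noncomputable section

open CategoryTheory AlgebraicGeometry Literature.AlgebraicGeometry.Resolution TopologicalSpace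

universe u

namespace Summit.ResolutionOfSingularities.ResolutionOfSingularities.Theorems.Picover.LogRegularFreeAtlas

/-- **Free charts are regular (Kato 1994, (10.4), the local ring computation).** Let
`φ : P → (R, ·)` be a chart through a Noetherian local ring `R` by a submonoid `P ⊆ ℤⁿ`
generated, as an additive monoid, by `n` vectors `b₁, …, bₙ` (e.g. a free monoid `ℕⁿ` on a
`ℤ`-basis), log regular in the sense of Kato (2.1) (`LogChart.IsLogRegularLocal`). Then `R` is a
regular local ring: with `uⱼ = φ(bⱼ)`, Kato's ideal is generated by the non-unit `uⱼ`, the face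
of units is spanned by the `bⱼ` with `uⱼ` a unit, and the two counts add up to at most `n`, so
`LogRegularFreeChart.isRegularLocalRing_of_isLogRegularLocal_of_span` applies.
[cite: Kato1994, (10.4) and Def. (2.1)] -/
theorem isRegularLocalRing_of_isLogRegularLocal_of_closure_range {R : Type u} [CommRing R]
    [IsNoetherianRing R] [IsLocalRing R] {n : ℕ} (P : AddSubmonoid (Fin n → ℤ))
    (φ : Multiplicative P →* R) (b : Fin n → (Fin n → ℤ))
    (hP : (P : Set (Fin n → ℤ)) = AddSubmonoid.closure (Set.range b))
    (h : LogChart.IsLogRegularLocal P φ) : IsRegularLocalRing R := by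
  classical
  -- the generators lie in `P`
  have hmem : ∀ {w : Fin n → ℤ}, w ∈ AddSubmonoid.closure (Set.range b) → w ∈ P := by
    intro w hw
    rw [← SetLike.mem_coe, hP]
    exact hw
  have hb : ∀ j, b j ∈ P := fun j => hmem (AddSubmonoid.subset_closure ⟨j, rfl⟩)
  -- images of the generators; `J` = indices of non-units, `K` = indices of units
  set u : Fin n → R := fun j => φ (Multiplicative.ofAdd ⟨b j, hb j⟩) with hu
  set J : Finset (Fin n) := Finset.univ.filter fun j => ¬ IsUnit (u j) with hJ
  set K : Finset (Fin n) := Finset.univ.filter fun j => IsUnit (u j) with hK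
  set q : Finset R := J.image u with hq
  set T : Finset (Fin n → ℤ) := K.image b with hT
  -- key dichotomy: a chart element is a non-unit lying in `(q)`, or a unit with exponent
  -- vector supported on `K`
  have key : ∀ (w : Fin n → ℤ) (hw : w ∈ P),
      (¬ IsUnit (φ (Multiplicative.ofAdd ⟨w, hw⟩)) →
          φ (Multiplicative.ofAdd ⟨w, hw⟩) ∈ Ideal.span (q : Set R)) ∧
        (IsUnit (φ (Multiplicative.ofAdd ⟨w, hw⟩)) →
          w ∈ Submodule.span ℤ (T : Set (Fin n → ℤ))) := by
    intro w hw
    have hw' : w ∈ AddSubmonoid.closure (Set.range b) := by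
      rw [← SetLike.mem_coe, ← hP]
      exact hw
    revert hw
    induction hw' using AddSubmonoid.closure_induction with
    | mem x hx =>
      obtain ⟨j, rfl⟩ := hx
      intro hw
      change (¬ IsUnit (u j) → u j ∈ _) ∧ (IsUnit (u j) → _)
      refine ⟨fun hj => Ideal.subset_span ?_, fun hj => Submodule.subset_span ?_⟩
      · rw [hq, Finset.coe_image]
        exact ⟨j, Finset.mem_coe.2 (Finset.mem_filter.2 ⟨Finset.mem_univ j, hj⟩), rfl⟩
      · rw [hT, Finset.coe_image]
        exact ⟨j, Finset.mem_coe.2 (Finset.mem_filter.2 ⟨Finset.mem_univ j, hj⟩), rfl⟩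
    | zero =>
      intro hw
      have h0 : (⟨0, hw⟩ : P) = 0 := rfl
      rw [h0, ofAdd_zero, map_one]
      exact ⟨fun h1 => (h1 isUnit_one).elim, fun _ => Submodule.zero_mem _⟩
    | add x y hx hy ihx ihy =>
      intro hw
      have hxP : x ∈ P := hmem hx
      have hyP : y ∈ P := hmem hy
      have hxy : (⟨x + y, hw⟩ : P) = ⟨x, hxP⟩ + ⟨y, hyP⟩ := rfl
      rw [hxy, ofAdd_add, map_mul]
      obtain ⟨hx₁, hx₂⟩ := ihx hxP
      obtain ⟨hy₁, hy₂⟩ := ihy hyP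
      refine ⟨fun hn => ?_, fun hun => ?_⟩
      · by_cases hxu : IsUnit (φ (Multiplicative.ofAdd ⟨x, hxP⟩))
        · have hyu : ¬ IsUnit (φ (Multiplicative.ofAdd ⟨y, hyP⟩)) := fun hyu => hn (hxu.mul hyu)
          exact Ideal.mul_mem_left _ _ (hy₁ hyu)
        · exact Ideal.mul_mem_right _ _ (hx₁ hxu)
      · obtain ⟨hxu, hyu⟩ := (Commute.all _ _).isUnit_mul_iff.1 hun
        exact Submodule.add_mem _ (hx₂ hxu) (hy₂ hyu)
  -- Kato's ideal is generated by `q`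
  have hI : LogChart.nonunitIdeal P φ = Ideal.span (q : Set R) := by
    refine le_antisymm (Ideal.span_le.2 ?_) (Ideal.span_le.2 ?_)
    · rintro _ ⟨⟨w, hw⟩, hv, rfl⟩
      exact (key w hw).1 hv
    · intro r hr
      rw [hq, Finset.coe_image] at hr
      obtain ⟨j, hj, rfl⟩ := hr
      have hj' : ¬ IsUnit (u j) := (Finset.mem_filter.1 (Finset.mem_coe.1 hj)).2
      exact Ideal.subset_span ⟨⟨b j, hb j⟩, hj', rfl⟩
  -- the face of units spans a lattice of rank at most `|K|`
  have hF : Submodule.span ℤ ((fun v : P => (v : Fin n → ℤ)) '' LogChart.unitFace P φ) ≤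
      Submodule.span ℤ (T : Set (Fin n → ℤ)) := by
    refine Submodule.span_le.2 ?_
    rintro _ ⟨⟨w, hw⟩, hv, rfl⟩
    exact (key w hw).2 hv
  have hrank : Module.finrank ℤ
      (Submodule.span ℤ ((fun v : P => (v : Fin n → ℤ)) '' LogChart.unitFace P φ)) ≤ K.card :=
    calc Module.finrank ℤ
          (Submodule.span ℤ ((fun v : P => (v : Fin n → ℤ)) '' LogChart.unitFace P φ))
        ≤ Module.finrank ℤ (Submodule.span ℤ (T : Set (Fin n → ℤ))) := Submodule.finrank_mono hF
      _ ≤ T.card := finrank_span_finset_le_card T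
      _ ≤ K.card := Finset.card_image_le
  -- count: `|q| + rank ≤ |J| + |K| = n`
  have hqJ : q.card ≤ J.card := Finset.card_image_le
  have hJK : K.card + J.card = n := by
    rw [hK, hJ, Finset.card_filter_add_card_filter_not, Finset.card_univ, Fintype.card_fin]
  exact LogRegularFreeChart.isRegularLocalRing_of_isLogRegularLocal_of_span P φ q h hI (by omega)

/-- **A scheme with a log-regular atlas by free chart monoids is regular** (Kato 1994, (10.4):
the terminal step, after the fan has been subdivided until all chart monoids are free). If every
chart monoid `P i ⊆ ℤ^{n i}` of a log-regular Zariski fs atlas `𝒜` on `X` is generated, as an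
additive monoid, by a `ℤ`-basis of `ℤ^{n i}` (so `P i ≅ ℕ^{n i}`), then every local ring of `X`
is regular: on the affine chart `U i ∋ x` the local ring is `Γ(X, U i)_𝔭`, where Kato's
condition (2.1) (`LogChart.isLogRegularAt_iff_isLogRegularLocal`) and the free-chart computation
`isRegularLocalRing_of_isLogRegularLocal_of_closure_range` give regularity.
[cite: Kato1994, (10.4)] -/
theorem isRegular_of_logRegularAtlas_of_free : ∀ (X : Scheme.{0}) (𝒜 : LogRegularAtlas X), (∀ i, ∃ b : Module.Basis (Fin (𝒜.n i)) ℤ (Fin (𝒜.n i) → ℤ), (𝒜.P i : Set (Fin (𝒜.n i) → ℤ)) = AddSubmonoid.closure (Set.range b)) → Scheme.IsRegular X := by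
  intro X 𝒜 hfree
  refine Scheme.isRegular_of_isRegularRing fun x => ?_
  have hx : x ∈ (⊤ : X.Opens) := trivial
  rw [← 𝒜.iSup_eq_top, Opens.mem_iSup] at hx
  obtain ⟨i, hi⟩ := hx
  refine ⟨(𝒜.U i : X.Opens), (𝒜.U i).2, hi, ?_⟩
  haveI := 𝒜.isNoetherianRing i
  rw [isRegularRing_iff]
  intro 𝔭 _
  obtain ⟨b, hb⟩ := hfree i
  exact isRegularLocalRing_of_isLogRegularLocal_of_closure_range (𝒜.P i) _ b hb
    ((LogChart.isLogRegularAt_iff_isLogRegularLocal (𝒜.P i) (𝒜.φ i) 𝔭).1 (𝒜.isLogRegularAt i 𝔭))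

end Summit.ResolutionOfSingularities.ResolutionOfSingularities.Theorems.Picover.LogRegularFreeAtlas

end
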